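import Summits.QuantumFields.BalabanUV.Beta.FP.SliceProjectorDiffChord

/-!
# `BalabanUV.Beta.FP.SliceProjectorDiffSymbol` — road «FP» (binder row D1), organisation γ, row GAMMA-3 «DIFFERENCE LETTERS OF `(1−Π)_N`» part 2∕3:
# THE DIFFERENCED BLOCH SYMBOLS `SDx`, `SDy`, `SDxy` (one unit step on the column ∕ row offset ∕ both), the DIFFERENCE IDENTITIES
# `S(a, b−e_μ) − S(a, b) = SDx`, `S(a−e_ν, b) − S(a, b) = SDy`, the mixed one, their n-UNIFORM BOUNDS ON THE STRIP `‖SDx‖, ‖SDy‖ ≤ 33·MS∕N`,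
# `‖SDxy‖ ≤ 33²·MS∕N²` (gen-8's `norm_S_le` with the chord factor absorbed by part 1's weighted alias sums) and their STRIP REGULARITY with those bounds

HONEST FRAMING (cell contract, verbatim): «discharging `BetaPertH` makes Bałaban's UV stability UNCONDITIONAL — a real constructive-QFT
result; it is NOT the continuum limit and NOT the Clay problem.»  HONEST DEPENDENCY (verbatim): «continuum YM on T⁴ ⇐ BetaPertH ∧ nine
spine estimates (0/9 proved); BetaPertH ⇐ (D1) ∧ (D4) ∧ CAP+tail; G-an2-4 gates asym, D1 and NE2/3/4.»  THIS MODULE DISCHARGES NOTHING of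
D1 ∕ BetaPertH: [folklore] finite-sum bookkeeping over `FP/SliceProjectorSymbol.S` ✓, `FP/SliceProjectorEntries.Aent` ✓ and part 1; [our object] data defs
`SDx`, `SDy`, `SDxy` (explicit finite alias sums); no `def … : Prop`; nothing is cited; 0 sorry.  NOT summit progress; NOT hbook, NOT D1, NOT BetaPertH,
NOT continuum, NOT Clay.

ABSOLUTE RULE (cell, verbatim): «No internally-minted statement may enter as a cited fact. Every hypothesis is either kernel-proved in this
package or a verbatim quotation of a PUBLISHED theorem with page reference. The manuscript(s) under audit are NOT citable for their own
disputed steps — they are the thing under adjudication; programme-internal (2001/route/tribunal) claims are never citable.»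

CONTENT (`D = d+1`, `N ≥ 1`, `e_μ = AffineAveraging.unitVec μ`):
* [our object] **`SDx`**, **`SDy`**, **`SDxy`**; **`S_sub_right`** (`S N a (b − e_μ) k − S N a b k = SDx N μ a b k`), **`S_sub_left`**, **`S_sub_sub`**
  (rank one: a column step multiplies the `l′`-th column character by `e^{i(k_{l′})_μ}`, a row step the `l`-th row character by `e^{−i(k_l)_ν}`);
  **`norm_SD_le`** (`‖SDx‖ ≤ 33·MS∕N ∧ ‖SDy‖ ≤ 33·MS∕N ∧ ‖SDxy‖ ≤ 33·33·MS∕N²` on `Strip D κ_Y`); `stripRegular_sub_of_bound` (difference of strip-regular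
  symbols with an independently proved bound); **`stripRegular_SD`** (the three symbols are strip-regular on `κ_Y` with the `1∕N`-improved bounds).
Unit `b2b-balaban-beta-d1-formalise-leaf-06` (gen 9), road «FP» OWNER GO R-FP-35 (e) journal l.27818 on INTENT l.27787 (offer O1 of l.27658); organisation γ (R-FP-25), row GAMMA-3 (in flight), under R-FP-33 (b)(c).
-/

noncomputable section

namespace Summit.QuantumFields.BalabanUV.Beta.FP.SliceProjectorDiffSymbol

open Complex Finset MeasureTheory
open scoped BigOperators Real
open Literature.MathematicalPhysics.QuantumFieldTheory.Balaban1983to89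
open Literature.MathematicalPhysics.QuantumFieldTheory.Balaban1983to89.Beta.AffineAveraging (unitVec unitVec_apply)
open B4Strip (Strip ofRealVec DeltaXi shift U)
open B4StripCauchy (Fat rOf rOf_le rOf_pos strip_subset_fat norm_DeltaXi_le norm_DeltaXi_shift_ge d_mul_rOf_sq_le)
open B5Strip145 (Ncal)
open B4ContourShift (BZ phase integrand fourierBox latticeKernel StripRegular supNorm latticeKernel_decay ofRealVec_mem_Strip)
open B4Green244 (latticeKernel_congr)
open Beta.FibreInverseDecay (cphase)
open Summit.QuantumFields.BalabanUV.Beta.GAN24.FibreSymbols (gsum pw pw_add pw_add_unitVec pw_sub_unitVec)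
open Summit.QuantumFields.BalabanUV.Beta.GAN24.AliasDecimate (aliasPt)
open Summit.QuantumFields.BalabanUV.Beta.GAN24.AliasStripSymbols (norm_cexp_I_mul_sub_one_le')
open Summit.QuantumFields.BalabanUV.Beta.FP.CoarseCovarianceStripAliasWeights (aliasPt_apply' aliasPt_im)
open Summit.QuantumFields.BalabanUV.Beta.FP.SliceProjectorMidInv (kapY kapY_pos kapY_le_rOf Ncal_lower)
open Summit.QuantumFields.BalabanUV.Beta.FP.SliceProjectorEntries (qa qb ew Aent ew_zero ew_ne qa_mul_qb strip_facts)
open Summit.QuantumFields.BalabanUV.Beta.FP.SliceProjectorSymbol (S)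
open Summit.QuantumFields.BalabanUV.Beta.FP.SliceProjectorAliasIndex (jt one_le_jt jt_pos jt_of_val_zero jt_eq_or c1 c1_pos fat_facts
  aliasPt_re_half aliasPt_im_mul norm_qa_le_prod norm_qb_le_prod)
open Summit.QuantumFields.BalabanUV.Beta.FP.SliceProjectorAliasSum (jt_sq_le_norm_DeltaXi_shift eD eD_pos eD_le_one eD_mul prod_jt_rpow_le
  wt wt_nonneg prod_wt_eq Cqe Cqe_nonneg sum_wt_le sum_prod_wt_eq sum_norm_qa_mul_ew_le sum_norm_qb_mul_ew_le l1 l1_neg norm_cphase_le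
  cN cN_pos MS CS exp_offset_le norm_Aent_eq stripRegular_S MS_le_CS)
open Summit.QuantumFields.BalabanUV.Beta.FP.SliceProjectorBlochChart
open Summit.QuantumFields.BalabanUV.Beta.FP.SliceProjectorBloch
open Summit.QuantumFields.BalabanUV.Beta.FP.SliceProjectorKernel
open Summit.QuantumFields.BalabanUV.Beta.FP.SliceProjectorKernelLaplace (cphase_add_unitVec cphase_sub_unitVec)
open Summit.QuantumFields.BalabanUV.Beta.FP.SliceProjectorDiffChord

variable {d : ℕ}

/-! ## §3 The differenced symbols: objects, the difference identities, n-uniform bounds with ONE extra factor `33·j̃∕N` per difference -/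

section Symbols

variable (N : ℕ) [NeZero N]

/-- [our object] the COLUMN-DIFFERENCED symbol (a unit step `e_μ` on the second offset):
`SDx N μ a b k := Σ_l Σ_l′ e^{ik_l·a}·A_{ll′}·(e^{−ik_{l′}·b}·(e^{i k_{l′,μ}} − 1))`. -/
def SDx (μ : Fin (d + 1)) (a b : Fin (d + 1) → ℤ) (k : Fin (d + 1) → ℂ) : ℂ :=
  ∑ l : Fin (d + 1) → Fin N, ∑ l' : Fin (d + 1) → Fin N,
    cphase a (aliasPt N l k) * Aent N l l' k * (cphase (-b) (aliasPt N l' k) * (cexp (I * aliasPt N l' k μ) - 1))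

/-- [our object] the ROW-DIFFERENCED symbol (a unit step `e_ν` on the first offset):
`SDy N ν a b k := Σ_l Σ_l′ ((e^{−i k_{l,ν}} − 1)·e^{ik_l·a})·A_{ll′}·e^{−ik_{l′}·b}`. -/
def SDy (ν : Fin (d + 1)) (a b : Fin (d + 1) → ℤ) (k : Fin (d + 1) → ℂ) : ℂ :=
  ∑ l : Fin (d + 1) → Fin N, ∑ l' : Fin (d + 1) → Fin N,
    ((cexp (-(I * aliasPt N l k ν)) - 1) * cphase a (aliasPt N l k)) * Aent N l l' k * cphase (-b) (aliasPt N l' k)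

/-- [our object] the MIXED twice-differenced symbol (one unit step on each offset). -/
def SDxy (μ ν : Fin (d + 1)) (a b : Fin (d + 1) → ℤ) (k : Fin (d + 1) → ℂ) : ℂ :=
  ∑ l : Fin (d + 1) → Fin N, ∑ l' : Fin (d + 1) → Fin N,
    ((cexp (-(I * aliasPt N l k ν)) - 1) * cphase a (aliasPt N l k)) * Aent N l l' k
      * (cphase (-b) (aliasPt N l' k) * (cexp (I * aliasPt N l' k μ) - 1))

/-- [folklore] **THE COLUMN DIFFERENCE IDENTITY**: `S N a (b − e_μ) k − S N a b k = SDx N μ a b k`. -/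
theorem S_sub_right (μ : Fin (d + 1)) (a b : Fin (d + 1) → ℤ) (k : Fin (d + 1) → ℂ) :
    S N a (b - unitVec μ) k - S N a b k = SDx N μ a b k := by
  unfold S SDx
  rw [← Finset.sum_sub_distrib]
  refine Finset.sum_congr rfl fun l _ => ?_
  rw [← Finset.sum_sub_distrib]
  refine Finset.sum_congr rfl fun l' _ => ?_
  rw [show -(b - unitVec μ) = -b + unitVec μ by abel, cphase_add_unitVec]
  ring

/-- [folklore] **THE ROW DIFFERENCE IDENTITY**: `S N (a − e_ν) b k − S N a b k = SDy N ν a b k`. -/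
theorem S_sub_left (ν : Fin (d + 1)) (a b : Fin (d + 1) → ℤ) (k : Fin (d + 1) → ℂ) :
    S N (a - unitVec ν) b k - S N a b k = SDy N ν a b k := by
  unfold S SDy
  rw [← Finset.sum_sub_distrib]
  refine Finset.sum_congr rfl fun l _ => ?_
  rw [← Finset.sum_sub_distrib]
  refine Finset.sum_congr rfl fun l' _ => ?_
  rw [cphase_sub_unitVec]
  ring

/-- [folklore] **THE MIXED DIFFERENCE IDENTITY**: `S(a−e_ν, b−e_μ) − S(a−e_ν, b) − S(a, b−e_μ) + S(a, b) = SDxy N μ ν a b`. -/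
theorem S_sub_sub (μ ν : Fin (d + 1)) (a b : Fin (d + 1) → ℤ) (k : Fin (d + 1) → ℂ) :
    S N (a - unitVec ν) (b - unitVec μ) k - S N (a - unitVec ν) b k - S N a (b - unitVec μ) k + S N a b k = SDxy N μ ν a b k := by
  rw [show S N (a - unitVec ν) (b - unitVec μ) k - S N (a - unitVec ν) b k - S N a (b - unitVec μ) k + S N a b k
      = (S N (a - unitVec ν) (b - unitVec μ) k - S N (a - unitVec ν) b k) - (S N a (b - unitVec μ) k - S N a b k) by ring,
    S_sub_right, S_sub_right]
  unfold SDx SDxy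
  rw [← Finset.sum_sub_distrib]
  refine Finset.sum_congr rfl fun l _ => ?_
  rw [← Finset.sum_sub_distrib]
  refine Finset.sum_congr rfl fun l' _ => ?_
  rw [cphase_sub_unitVec]
  ring

/-- [our object] **THE BOUNDS ON THE STRIP** (`k ∈ Strip D κ_Y`, every `N ≥ 1`): `‖SDx‖ ≤ 33·MS∕N`, `‖SDy‖ ≤ 33·MS∕N`, `‖SDxy‖ ≤ 33²·MS∕N²` —
gen-8's `norm_S_le` with the chord factor `33·j̃∕N` absorbed by the weighted alias sums of §2. -/
theorem norm_SD_le (μ ν : Fin (d + 1)) (a b : Fin (d + 1) → ℤ) {k : Fin (d + 1) → ℂ} (hk : k ∈ Strip (d + 1) (kapY (d + 1))) :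
    ‖SDx N μ a b k‖ ≤ 33 * MS d N a b / N ∧ ‖SDy N ν a b k‖ ≤ 33 * MS d N a b / N ∧
      ‖SDxy N μ ν a b k‖ ≤ 33 * 33 * MS d N a b / ((N : ℝ) * N) := by
  have hn : (0 : ℝ) < N := by exact_mod_cast Nat.pos_of_ne_zero (NeZero.ne N)
  have hfat : k ∈ Fat (d + 1) (rOf (d + 1)) := strip_subset_fat (rOf_pos _).le (kapY_le_rOf _) hk
  have hN : cN d ≤ ‖Ncal N k‖ := Ncal_lower N k hk
  have hcN := cN_pos d
  have him : ∀ (l : Fin (d + 1) → Fin N) (μ : Fin (d + 1)), |(aliasPt N l k μ).im| ≤ kapY (d + 1) / N := fun l μ => by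
    rw [aliasPt_im, abs_div, Nat.abs_cast]; exact div_le_div_of_nonneg_right (hk μ).2 hn.le
  set Ea := Real.exp (kapY (d + 1) / N * l1 a) with hEa
  set Eb := Real.exp (kapY (d + 1) / N * l1 b) with hEb
  have h1 : ∀ l : Fin (d + 1) → Fin N, ‖cphase a (aliasPt N l k)‖ ≤ Ea := fun l => norm_cphase_le (him l) a
  have h2 : ∀ l' : Fin (d + 1) → Fin N, ‖cphase (-b) (aliasPt N l' k)‖ ≤ Eb := fun l' => by
    have h := norm_cphase_le (him l') (-b); rwa [l1_neg] at h
  have hchx : ∀ l' : Fin (d + 1) → Fin N, ‖cexp (I * aliasPt N l' k μ) - 1‖ ≤ 33 * jt N (l' μ) / N := fun l' => by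
    simpa using norm_cexp_aliasPt_sub_one_le N hfat l' μ 1 (Or.inl rfl)
  have hchy : ∀ l : Fin (d + 1) → Fin N, ‖cexp (-(I * aliasPt N l k ν)) - 1‖ ≤ 33 * jt N (l ν) / N := fun l => by
    have h := norm_cexp_aliasPt_sub_one_le N hfat l ν (-1) (Or.inr rfl)
    simpa using h
  have hA : ∀ l l' : Fin (d + 1) → Fin N, ‖Aent N l l' k‖ ≤ (‖qa N l k‖ * ‖ew N l k‖) * (‖qb N l' k‖ * ‖ew N l' k‖) / cN d := fun l l' => by
    rw [norm_Aent_eq]; exact div_le_div_of_nonneg_left (by positivity) hcN hN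
  have hj0 : ∀ (l : Fin (d + 1) → Fin N) (i : Fin (d + 1)), (0 : ℝ) ≤ 33 * jt N (l i) / N := fun l i =>
    div_nonneg (mul_nonneg (by norm_num) (jt_pos _).le) hn.le
  have hEa0 : 0 ≤ Ea := (Real.exp_pos _).le
  have hEb0 : 0 ≤ Eb := (Real.exp_pos _).le
  have hA0 : ∀ l l' : Fin (d + 1) → Fin N, 0 ≤ (‖qa N l k‖ * ‖ew N l k‖) * (‖qb N l' k‖ * ‖ew N l' k‖) / cN d := fun l l' => by positivity
  -- the three termwise bounds
  have hTx : ∀ l l', ‖cphase a (aliasPt N l k) * Aent N l l' k * (cphase (-b) (aliasPt N l' k) * (cexp (I * aliasPt N l' k μ) - 1))‖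
      ≤ Ea * Eb / cN d * (33 / N) * ((‖qa N l k‖ * ‖ew N l k‖) * (jt N (l' μ) * (‖qb N l' k‖ * ‖ew N l' k‖))) := by
    intro l l'
    rw [norm_mul, norm_mul, norm_mul]
    calc ‖cphase a (aliasPt N l k)‖ * ‖Aent N l l' k‖ * (‖cphase (-b) (aliasPt N l' k)‖ * ‖cexp (I * aliasPt N l' k μ) - 1‖)
        ≤ Ea * ((‖qa N l k‖ * ‖ew N l k‖) * (‖qb N l' k‖ * ‖ew N l' k‖) / cN d) * (Eb * (33 * jt N (l' μ) / N)) :=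
          mul_le_mul (mul_le_mul (h1 l) (hA l l') (norm_nonneg _) hEa0)
            (mul_le_mul (h2 l') (hchx l') (norm_nonneg _) hEb0) (by positivity) (mul_nonneg hEa0 (hA0 l l'))
      _ = _ := by ring
  have hTy : ∀ l l', ‖((cexp (-(I * aliasPt N l k ν)) - 1) * cphase a (aliasPt N l k)) * Aent N l l' k * cphase (-b) (aliasPt N l' k)‖
      ≤ Ea * Eb / cN d * (33 / N) * ((jt N (l ν) * (‖qa N l k‖ * ‖ew N l k‖)) * (‖qb N l' k‖ * ‖ew N l' k‖)) := by
    intro l l'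
    rw [norm_mul, norm_mul, norm_mul]
    calc ‖cexp (-(I * aliasPt N l k ν)) - 1‖ * ‖cphase a (aliasPt N l k)‖ * ‖Aent N l l' k‖ * ‖cphase (-b) (aliasPt N l' k)‖
        ≤ (33 * jt N (l ν) / N) * Ea * ((‖qa N l k‖ * ‖ew N l k‖) * (‖qb N l' k‖ * ‖ew N l' k‖) / cN d) * Eb :=
          mul_le_mul (mul_le_mul (mul_le_mul (hchy l) (h1 l) (norm_nonneg _) (hj0 l ν)) (hA l l') (norm_nonneg _)
            (mul_nonneg (hj0 l ν) hEa0)) (h2 l') (norm_nonneg _) (mul_nonneg (mul_nonneg (hj0 l ν) hEa0) (hA0 l l'))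
      _ = _ := by ring
  have hTxy : ∀ l l', ‖((cexp (-(I * aliasPt N l k ν)) - 1) * cphase a (aliasPt N l k)) * Aent N l l' k
        * (cphase (-b) (aliasPt N l' k) * (cexp (I * aliasPt N l' k μ) - 1))‖
      ≤ Ea * Eb / cN d * (33 / N) * (33 / N) * ((jt N (l ν) * (‖qa N l k‖ * ‖ew N l k‖)) * (jt N (l' μ) * (‖qb N l' k‖ * ‖ew N l' k‖))) := by
    intro l l'
    rw [norm_mul, norm_mul, norm_mul, norm_mul]
    calc ‖cexp (-(I * aliasPt N l k ν)) - 1‖ * ‖cphase a (aliasPt N l k)‖ * ‖Aent N l l' k‖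
          * (‖cphase (-b) (aliasPt N l' k)‖ * ‖cexp (I * aliasPt N l' k μ) - 1‖)
        ≤ (33 * jt N (l ν) / N) * Ea * ((‖qa N l k‖ * ‖ew N l k‖) * (‖qb N l' k‖ * ‖ew N l' k‖) / cN d) * (Eb * (33 * jt N (l' μ) / N)) :=
          mul_le_mul (mul_le_mul (mul_le_mul (hchy l) (h1 l) (norm_nonneg _) (hj0 l ν)) (hA l l') (norm_nonneg _)
            (mul_nonneg (hj0 l ν) hEa0)) (mul_le_mul (h2 l') (hchx l') (norm_nonneg _) hEb0) (by positivity)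
            (mul_nonneg (mul_nonneg (hj0 l ν) hEa0) (hA0 l l'))
      _ = _ := by ring
  -- the alias sums
  have hSa := sum_norm_qa_mul_ew_le N hfat
  have hSb := sum_norm_qb_mul_ew_le N hfat
  have hSaj := (sum_jt_mul_norm_q_mul_ew_le N hfat ν).1
  have hSbj := (sum_jt_mul_norm_q_mul_ew_le N hfat μ).2
  have hS0 : 0 ≤ ∑ l : Fin (d + 1) → Fin N, ‖qb N l k‖ * ‖ew N l k‖ := Finset.sum_nonneg fun l _ => by positivity
  have hS0j : 0 ≤ ∑ l : Fin (d + 1) → Fin N, jt N (l ν) * (‖qa N l k‖ * ‖ew N l k‖) :=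
    Finset.sum_nonneg fun l _ => mul_nonneg (jt_pos _).le (by positivity)
  have hMS : Ea * Eb / cN d * (Cqe d * Cqe d) = MS d N a b := by rw [MS, sq]; ring
  refine ⟨?_, ?_, ?_⟩
  · calc ‖SDx N μ a b k‖ ≤ ∑ l, ∑ l', ‖cphase a (aliasPt N l k) * Aent N l l' k * (cphase (-b) (aliasPt N l' k) * (cexp (I * aliasPt N l' k μ) - 1))‖ := by
          unfold SDx; exact (norm_sum_le _ _).trans (Finset.sum_le_sum fun l _ => norm_sum_le _ _)
      _ ≤ ∑ l : Fin (d + 1) → Fin N, ∑ l' : Fin (d + 1) → Fin N,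
            Ea * Eb / cN d * (33 / N) * ((‖qa N l k‖ * ‖ew N l k‖) * (jt N (l' μ) * (‖qb N l' k‖ * ‖ew N l' k‖))) :=
          Finset.sum_le_sum fun l _ => Finset.sum_le_sum fun l' _ => hTx l l'
      _ = Ea * Eb / cN d * (33 / N) * ((∑ l : Fin (d + 1) → Fin N, ‖qa N l k‖ * ‖ew N l k‖)
            * ∑ l' : Fin (d + 1) → Fin N, jt N (l' μ) * (‖qb N l' k‖ * ‖ew N l' k‖)) := by
          rw [Finset.sum_mul_sum, Finset.mul_sum]
          exact Finset.sum_congr rfl fun l _ => by rw [Finset.mul_sum]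
      _ ≤ Ea * Eb / cN d * (33 / N) * (Cqe d * Cqe d) :=
          mul_le_mul_of_nonneg_left (mul_le_mul hSa hSbj (Finset.sum_nonneg fun l _ => mul_nonneg (jt_pos _).le (by positivity))
            (Cqe_nonneg d)) (by positivity)
      _ = 33 * MS d N a b / N := by rw [← hMS]; field_simp
  · calc ‖SDy N ν a b k‖ ≤ ∑ l, ∑ l', ‖((cexp (-(I * aliasPt N l k ν)) - 1) * cphase a (aliasPt N l k)) * Aent N l l' k * cphase (-b) (aliasPt N l' k)‖ := by
          unfold SDy; exact (norm_sum_le _ _).trans (Finset.sum_le_sum fun l _ => norm_sum_le _ _)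
      _ ≤ ∑ l : Fin (d + 1) → Fin N, ∑ l' : Fin (d + 1) → Fin N,
            Ea * Eb / cN d * (33 / N) * ((jt N (l ν) * (‖qa N l k‖ * ‖ew N l k‖)) * (‖qb N l' k‖ * ‖ew N l' k‖)) :=
          Finset.sum_le_sum fun l _ => Finset.sum_le_sum fun l' _ => hTy l l'
      _ = Ea * Eb / cN d * (33 / N) * ((∑ l : Fin (d + 1) → Fin N, jt N (l ν) * (‖qa N l k‖ * ‖ew N l k‖))
            * ∑ l' : Fin (d + 1) → Fin N, ‖qb N l' k‖ * ‖ew N l' k‖) := by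
          rw [Finset.sum_mul_sum, Finset.mul_sum]
          exact Finset.sum_congr rfl fun l _ => by rw [Finset.mul_sum]
      _ ≤ Ea * Eb / cN d * (33 / N) * (Cqe d * Cqe d) :=
          mul_le_mul_of_nonneg_left (mul_le_mul hSaj hSb hS0 (Cqe_nonneg d)) (by positivity)
      _ = 33 * MS d N a b / N := by rw [← hMS]; field_simp
  · calc ‖SDxy N μ ν a b k‖ ≤ ∑ l, ∑ l', ‖((cexp (-(I * aliasPt N l k ν)) - 1) * cphase a (aliasPt N l k)) * Aent N l l' k
            * (cphase (-b) (aliasPt N l' k) * (cexp (I * aliasPt N l' k μ) - 1))‖ := by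
          unfold SDxy; exact (norm_sum_le _ _).trans (Finset.sum_le_sum fun l _ => norm_sum_le _ _)
      _ ≤ ∑ l : Fin (d + 1) → Fin N, ∑ l' : Fin (d + 1) → Fin N, Ea * Eb / cN d * (33 / N) * (33 / N)
            * ((jt N (l ν) * (‖qa N l k‖ * ‖ew N l k‖)) * (jt N (l' μ) * (‖qb N l' k‖ * ‖ew N l' k‖))) :=
          Finset.sum_le_sum fun l _ => Finset.sum_le_sum fun l' _ => hTxy l l'
      _ = Ea * Eb / cN d * (33 / N) * (33 / N) * ((∑ l : Fin (d + 1) → Fin N, jt N (l ν) * (‖qa N l k‖ * ‖ew N l k‖))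
            * ∑ l' : Fin (d + 1) → Fin N, jt N (l' μ) * (‖qb N l' k‖ * ‖ew N l' k‖)) := by
          rw [Finset.sum_mul_sum, Finset.mul_sum]
          exact Finset.sum_congr rfl fun l _ => by rw [Finset.mul_sum]
      _ ≤ Ea * Eb / cN d * (33 / N) * (33 / N) * (Cqe d * Cqe d) :=
          mul_le_mul_of_nonneg_left (mul_le_mul hSaj hSbj (Finset.sum_nonneg fun l _ => mul_nonneg (jt_pos _).le (by positivity))
            (Cqe_nonneg d)) (by positivity)
      _ = 33 * 33 * MS d N a b / ((N : ℝ) * N) := by rw [← hMS]; field_simp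

/-- [folklore] the difference of two strip-regular symbols with an independently known bound is strip-regular with THAT bound. -/
theorem stripRegular_sub_of_bound {G₁ G₂ : (Fin (d + 1) → ℂ) → ℂ} {κ M₁ M₂ M : ℝ} (h₁ : StripRegular G₁ κ M₁) (h₂ : StripRegular G₂ κ M₂)
    (hM : ∀ p ∈ Strip (d + 1) κ, ‖G₁ p - G₂ p‖ ≤ M) : StripRegular (fun p => G₁ p - G₂ p) κ M :=
  ⟨h₁.cont.sub h₂.cont, fun i q hq => (h₁.diff i q hq).sub (h₂.diff i q hq),
    fun i q hq y hy => by simp only [h₁.sides i q hq y hy, h₂.sides i q hq y hy], hM⟩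

/-- [our object] **STRIP REGULARITY OF THE DIFFERENCED SYMBOLS** with the `1∕N`-improved bounds. -/
theorem stripRegular_SD (μ ν : Fin (d + 1)) (a b : Fin (d + 1) → ℤ) :
    StripRegular (d := d) (SDx N μ a b) (kapY (d + 1)) (33 * MS d N a b / N) ∧
      StripRegular (d := d) (SDy N ν a b) (kapY (d + 1)) (33 * MS d N a b / N) ∧
        StripRegular (d := d) (SDxy N μ ν a b) (kapY (d + 1)) (33 * 33 * MS d N a b / ((N : ℝ) * N)) := by
  have hx : (fun p => S N a (b - unitVec μ) p - S N a b p) = SDx N μ a b := funext fun p => S_sub_right N μ a b p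
  have hy : (fun p => S N (a - unitVec ν) b p - S N a b p) = SDy N ν a b := funext fun p => S_sub_left N ν a b p
  have hxy : (fun p => (S N (a - unitVec ν) (b - unitVec μ) p - S N (a - unitVec ν) b p) - (S N a (b - unitVec μ) p - S N a b p))
      = SDxy N μ ν a b := funext fun p => by rw [← S_sub_sub]; ring
  refine ⟨?_, ?_, ?_⟩
  · have h := stripRegular_sub_of_bound (stripRegular_S N a (b - unitVec μ)) (stripRegular_S N a b)
      (fun p hp => by rw [S_sub_right]; exact (norm_SD_le N μ ν a b hp).1)
    rwa [hx] at h
  · have h := stripRegular_sub_of_bound (stripRegular_S N (a - unitVec ν) b) (stripRegular_S N a b)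
      (fun p hp => by rw [S_sub_left]; exact (norm_SD_le N μ ν a b hp).2.1)
    rwa [hy] at h
  · have hG1 := stripRegular_sub_of_bound (stripRegular_S N (a - unitVec ν) (b - unitVec μ)) (stripRegular_S N (a - unitVec ν) b)
      (M := MS d N (a - unitVec ν) (b - unitVec μ) + MS d N (a - unitVec ν) b)
      (fun p hp => (norm_sub_le _ _).trans (add_le_add ((stripRegular_S N (a - unitVec ν) (b - unitVec μ)).bound p hp)
        ((stripRegular_S N (a - unitVec ν) b).bound p hp)))
    have hG2 := stripRegular_sub_of_bound (stripRegular_S N a (b - unitVec μ)) (stripRegular_S N a b)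
      (M := MS d N a (b - unitVec μ) + MS d N a b)
      (fun p hp => (norm_sub_le _ _).trans (add_le_add ((stripRegular_S N a (b - unitVec μ)).bound p hp) ((stripRegular_S N a b).bound p hp)))
    have h := stripRegular_sub_of_bound hG1 hG2 (M := 33 * 33 * MS d N a b / ((N : ℝ) * N))
      (fun p hp => by
        have e : (S N (a - unitVec ν) (b - unitVec μ) p - S N (a - unitVec ν) b p) - (S N a (b - unitVec μ) p - S N a b p) = SDxy N μ ν a b p := by
          rw [← S_sub_sub]; ring
        rw [e]; exact (norm_SD_le N μ ν a b hp).2.2)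
    rwa [hxy] at h

end Symbols

end Summit.QuantumFields.BalabanUV.Beta.FP.SliceProjectorDiffSymbol

end
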